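/-
Origin: expansion seat `planner-pub-hodgecm-pv04-g2-0`, handover 2026-08-18 (`HOME/pub-hodgecm-pv04-g2/lean/Pv04g2/ToyCMInflation.lean`, md5 5c4bb715, 139 lines);
landed by the gen-6 packager in gate run 22 as `HodgeCM/Model/Toy/CMInflation.lean` (import ^import Pv[0-9]+g[0-9]+\.→import HodgeCM.PerL34. ×1).
-/
-- HANDOVER (planner-pub-hodgecm-pv04-g2-0, unit pub-hodgecm-pv04-g2): WIP module `Pv04g2.ToyCMInflation`; intended
-- final module `HodgeCM.Model.Toy.CMInflation` (kind L5-supplement: toy-model witness of the model fact M38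
-- `Universe.Fact_cmInflation` of `Pv04g2.ThetaSubOfLiu` / `HodgeCM.PerL34.ThetaSubOfLiu`); rename
-- `import Pv04g2.ThetaSubOfLiu` ↦ the landed module name.
/-
Copyright: pub-hodgecm cell (HodgeCMPerL). Consistency-witness layer (part (e), referee A G4).

# The toy universe satisfies M38 (`Fact_cmInflation`)

For a CM-field embedding `k : K →+* M` and a CM type `Φ` of `K`, the inflated type
`CMTypeOps.inflate k Φ` is *definitionally* the toy seat's `inducedType K M k Φ`, and the toy seat's
pull-back `π^* = jj : FK K → FK M` (`HodgeCM.Toy.piHom`) is a Hodge map `A_{(M, inflate k Φ)} ⟶ A_{(K,Φ)}`.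
Choosing a `K`-basis `γ₁,…,γ_m` of `M` (through `k`), the morphisms `p_j := [γ_j] ∘ π` have pull-backs
`x ↦ γ_j · k(x)`, so `⊕_j p_j^* : H¹(A_{(K,Φ)})^m → H¹(A_{(M, inflate k Φ)})` is `M = ⊕_j k(K)γ_j`, a bijection,
and each `p_j^*` intertwines `ι_Φ(a)` with `ι_{inflate Φ}(k a)` because `M` is commutative.
Hence `(toyModelWith D).Fact_cmInflation` holds for every Hodge datum `D`: the new model fact M38 is
consistent with the 28 recorded model axioms (all witnessed on `toyModelWith D`, `HodgeCM.Model.Toy.Toy`).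

PRINT source of M38 itself: Shimura, *Abelian Varieties with Complex Multiplication and Modular Functions*
(1998), §6.2 Thm. 3 and its proof, §6.1 Thm. 2 Cor. + Remark — see the docstring of `Universe.Fact_cmInflation`.
-/
import Summits.HodgeConjecture.HodgeCM.Model.Toy.Toy
import Summits.HodgeConjecture.HodgeCM.PerL34.ThetaSubOfLiu_2

/-! PORT of `HodgeCM/Model/Toy/CMInflation.lean` (HodgeCMPerL run 82) — verbatim mechanical port; provenance in the PORT header line. -/

namespace HodgeCM.Toy

open Literature.AlgebraicGeometry.Motives
open CMPresentation exteriorPower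
open scoped TensorProduct

noncomputable section

section cmInflation

variable (K M : CMField) (k : (K : Type) →+* (M : Type)) (Φ : CMType K)

/-- The inflated CM type of `ThetaSubOfLiu` is the toy seat's induced type (definitionally). -/
lemma inflate_eq_inducedType : CMTypeOps.inflate k Φ = inducedType K M k Φ := rfl

/-- A `K`-basis of `M` through `k`: `M = ⊕_j k(K) γ_j`. -/
lemma exists_kBasis : ∃ (m : ℕ) (γ : Fin m → (M : Type)),
    Function.Bijective (fun c : Fin m → (K : Type) => ∑ j, k (c j) * γ j) := by
  classical
  letI : Algebra K M := k.toAlgebra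
  haveI : Module.Finite K M := Module.Finite.of_restrictScalars_finite ℚ K M
  let b := Module.finBasis K M
  refine ⟨Module.finrank K M, b, ?_⟩
  have h : (fun c : Fin (Module.finrank K M) → (K : Type) => ∑ j, k (c j) * b j) = b.equivFun.symm := by
    funext c
    rw [Module.Basis.equivFun_symm_apply]
    rfl
  rw [h]
  exact b.equivFun.symm.bijective

/-- (Ported verbatim from the HodgeCMPerL package; no docstring in the source.) -/
lemma jj_apply' (y : FK K) : jj K M k y = eK M (k ((eK K).symm y)) := by
  conv_lhs => rw [← (eK K).apply_symm_apply y]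
  exact jj_eK K M k _

/-- `p_γ := [γ] ∘ π : A_{(M, inflate k Φ)} ⟶ A_{(K,Φ)}` — pull-back `x ↦ γ · k(x)` on lattices. -/
def pHom (γ : (M : Type)) : Obj.Hom (cmObj M (CMTypeOps.inflate k Φ)) (cmObj K Φ) :=
  (mulHom M (CMTypeOps.inflate k Φ) γ).comp (piHom K M k Φ)

/-- (Ported verbatim from the HodgeCMPerL package; no docstring in the source.) -/
lemma pHom_lin_apply (γ : (M : Type)) (v : (cmObj K Φ).L) (u : Unit) :
    (pHom K M k Φ γ).lin v u = eK M γ * jj K M k (v u) := by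
  simp [pHom, Obj.Hom.comp, mulHom, mulK, piHom, piLin, LinearMap.mulLeft_apply, Pi.mul_apply]

/-- `p_γ^*` intertwines the CM actions: `p_γ^* ∘ ι_Φ(a) = ι(k a) ∘ p_γ^*` (commutativity of `M`). -/
lemma pHom_lin_comp_mulK (γ : (M : Type)) (a : K) :
    (pHom K M k Φ γ).lin ∘ₗ mulK K Φ a = mulK M (CMTypeOps.inflate k Φ) (k a) ∘ₗ (pHom K M k Φ γ).lin := by
  refine LinearMap.ext fun v => funext fun u => ?_
  simp only [LinearMap.coe_comp, Function.comp_apply, pHom_lin_apply]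
  simp only [mulK, LinearMap.mulLeft_apply, Pi.mul_apply, kToL_apply, map_mul, jj_eK]
  rw [pHom_lin_apply, mul_left_comm]

/-- `oneEquiv (map 1 φ x) = φ (oneEquiv x)`. -/
lemma oneEquiv_map_one {X Y : Obj} (φ : Y.L →ₗ[ℚ] X.L) (x : ↥(⋀[ℚ]^1 Y.L)) :
    oneEquiv ℚ X.L (map 1 φ x) = φ (oneEquiv ℚ Y.L x) :=
  LinearMap.congr_fun (oneEquiv_naturality φ) x

variable (D : HodgeData)

/-- **M38 holds in the toy universe.** -/
theorem fact_cmInflation : (toyModelWith D).Fact_cmInflation := by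
  classical
  intro K M k Φ
  obtain ⟨m, γ, hγ⟩ := exists_kBasis K M k
  refine ⟨m, fun j => pHom K M k Φ (γ j), ?_, fun j a => ?_⟩
  · -- bijectivity of `⊕_j p_j^*`
    set S : (Fin m → ↥(⋀[ℚ]^1 (cmObj K Φ).L)) →ₗ[ℚ] ↥(⋀[ℚ]^1 (cmObj M (CMTypeOps.inflate k Φ)).L) :=
      ∑ j : Fin m, map 1 (pHom K M k Φ (γ j)).lin ∘ₗ LinearMap.proj j with hS_def
    change Function.Bijective S
    -- the three bijections `S` factors through
    let e₁ : ↥(⋀[ℚ]^1 (cmObj K Φ).L) → K.K := fun x => (eK K).symm (oneEquiv ℚ (cmObj K Φ).L x ())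
    let e₃ : M.K → ↥(⋀[ℚ]^1 (cmObj M (CMTypeOps.inflate k Φ)).L) :=
      fun y => (oneEquiv ℚ (cmObj M (CMTypeOps.inflate k Φ)).L).symm (fun _ => eK M y)
    have hev : Function.Bijective (fun f : (cmObj K Φ).L => f ()) :=
      ⟨fun f g h => funext fun u => by cases u; exact h, fun b => ⟨fun _ => b, rfl⟩⟩
    have hconst : Function.Bijective (fun (y : FK M) (_ : Unit) => y) :=
      ⟨fun a b h => congr_fun h (), fun f => ⟨f (), funext fun u => by cases u; rfl⟩⟩
    have he₁ : Function.Bijective e₁ := by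
      change Function.Bijective (((eK K).symm : FK K → K.K) ∘ (fun f : (cmObj K Φ).L => f ())
        ∘ ⇑(oneEquiv ℚ (cmObj K Φ).L))
      exact (eK K).symm.bijective.comp (hev.comp (oneEquiv ℚ (cmObj K Φ).L).bijective)
    have he₃ : Function.Bijective e₃ := by
      change Function.Bijective (⇑(oneEquiv ℚ (cmObj M (CMTypeOps.inflate k Φ)).L).symm
        ∘ (fun (y : FK M) (_ : Unit) => y) ∘ ((eK M) : M.K → FK M))
      exact (oneEquiv ℚ _).symm.bijective.comp (hconst.comp (eK M).bijective)
    have hS : ⇑S = e₃ ∘ (fun c : Fin m → (K : Type) => ∑ j, k (c j) * γ j) ∘ (e₁ ∘ ·) := by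
      funext w
      apply (oneEquiv ℚ (cmObj M (CMTypeOps.inflate k Φ)).L).injective
      simp only [Function.comp_apply, e₃, LinearEquiv.apply_symm_apply]
      funext u
      rw [hS_def, LinearMap.sum_apply, map_sum, Finset.sum_apply]
      simp only [LinearMap.coe_comp, Function.comp_apply, LinearMap.proj_apply, oneEquiv_map_one,
        pHom_lin_apply, map_sum, map_mul, e₁, jj_apply']
      refine Finset.sum_congr rfl fun j _ => ?_
      cases u
      rw [mul_comm]
    rw [hS]
    exact he₃.comp (hγ.comp he₁.comp_left)
  · -- equivariance
    simp only [cmAction_ι]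
    change map 1 (pHom K M k Φ (γ j)).lin ∘ₗ map 1 (mulK K Φ a)
      = map 1 (mulK M (CMTypeOps.inflate k Φ) (k a)) ∘ₗ map 1 (pHom K M k Φ (γ j)).lin
    rw [← map_comp, ← map_comp, pHom_lin_comp_mulK]

end cmInflation

/-- **Consistency of the record extended by M38.** The package's toy universe `toyModel` satisfies the
28 recorded model axioms *and* `Fact_cmInflation`, from the same single typed input `h28` as
`toyModel_axioms` (`HodgeCM.Model.Toy.Toy`). (In the toy universe `H¹(P_Γ) = 0`, so `Open_thetaSub` is
trivially true there; the content of this corollary is the joint satisfiability of M1–M28 and M38.) -/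
theorem toyModel_axioms_and_cmInflation (h28 : toyModel.Fact_algDuality) :
    toyModel.ModelAxioms ∧ toyModel.Fact_cmInflation :=
  ⟨toyModel_axioms h28, fact_cmInflation exteriorHodgeData⟩

end

end HodgeCM.Toy
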